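import Mathlib
import HarnessLib
import Literature.AlgebraicGeometry.Ramification.InertiaNormalSylow
import Literature.AlgebraicGeometry.Resolution.ResolutionOfSingularities
import Summits.ResolutionOfSingularities.ResolutionOfSingularities.Theorems.WildQuotientsWildQuotientResolutionKernelCorePhaseZero

/-!
# The fixed LINE of a tame subgroup: local algebra and germs for non-cyclic tame cores
# (crux `WildQuotients.WildQuotientResolution`, stub `stub_phaseZeroHighDim`; any dimension)

Crux stmt-ResolutionOfSingularities-15640 (`WildQuotientResolution`), registered stub `stub_phaseZeroHighDim`.
Local input of the companion file `…NonCyclicCorePhaseZero` (Phase 0 along NON-CYCLIC tame cores, e.g. `V₄ ⊴ S₄`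
in characteristic `3`): the engines ✓p822635/✓p823606 only book-keep cyclic overgroups `⟨g⟩ ≥ M` of a core `M`,
reading the boundary through the prime `𝔞_g`; here the same is done for the fixed-locus ideal
`𝔞_{M,x} = ⨆_{m ∈ M} 𝔞_{τ m}` of a tame SUBGROUP `M ≤ I_x` (prime on a regular stalk: ✓`TameFixedLocus`).

* `sum_apply_mem_sq_of_mem_iSup_augIdeal`, `mem_sq_of_mem_iSup_augIdeal_sup` — for a finite group `M` of
  invertible order acting residue-trivially on a local ring, a first-order vector FIXED by all of `M` and lying in
  `𝔞_M + 𝔪²` is in `𝔪²` (trace argument; subgroup form of ✓`mem_sq_of_mem_augIdeal_sup`).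
* `isPrime_iSup_augIdeal`, `exists_mem_of_stalkIdeal_suppUnion_le_iSup`, `exists_mem_stalkIdeal_le_iSup_of_subset_iUnion`
  — if `Z_M ⊆ ⋃ boundary` and `M ≤ I_x`, some boundary divisor `D ∋ x` has `I(D)_x ≤ 𝔞_{M,x}`.
* `exists_lineKernel` — the joint kernel `U` of the line characters of a subgroup `I ≤ I_x` with its defining
  property `u ∈ U ⇒ τ u zᵢ − zᵢ ∈ 𝔪²`, pushed into `G` (normal in `I`, `[I,I] ≤ U`, closed under `p`-th roots).

[OURS · crux stmt-ResolutionOfSingularities-15640 · helper toward `stub_phaseZeroHighDim`; folklore local algebra,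
counted 0; AI-level work, weaker than expert review.] [folklore]
-/

-- single-problem summit: the doubled namespace component `ResolutionOfSingularities` is forced
set_option linter.dupNamespace false

noncomputable section

open CategoryTheory AlgebraicGeometry TopologicalSpace IsLocalRing
open Literature.AlgebraicGeometry.Resolution Literature.AlgebraicGeometry.Ramification
open Scheme.IdealSheafData
open Summit.ResolutionOfSingularities.ResolutionOfSingularities.Theorems.WildQuotientResolution.PointBlowupStalkData
open Summit.ResolutionOfSingularities.ResolutionOfSingularities.Theorems.WildQuotientResolution.InertLocusStalk

namespace Summit.ResolutionOfSingularities.ResolutionOfSingularities.Theorems.WildQuotientResolution.StandardForm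

/-! ## Local algebra: an `M`-fixed first-order vector in the fixed-locus ideal of a tame group is zero -/

section LocalRing

variable {R : Type*} [CommRing R] [IsLocalRing R] {M : Type*} [Group M] [Fintype M]

/-- The trace of an element of the fixed-locus ideal `⨆_m 𝔞_m` of a tame (invertible order) residue-trivial action
lies in `𝔪²`: each `𝔞_m` is `(m − 1)𝔪` modulo `𝔪²` (✓`exists_sub_mem_sq_of_mem_augIdeal`) and the trace kills
`(m − 1)R` (✓`TameFixedLocus.sum_apply_sub_self`). [folklore] -/
theorem sum_apply_mem_sq_of_mem_iSup_augIdeal (τ : M →* (R ≃+* R))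
    (hres : ∀ (m : M) (r : R), τ m r - r ∈ maximalIdeal R) (hMu : IsUnit ((Fintype.card M : ℕ) : R))
    {a : R} (ha : a ∈ ⨆ m, augIdeal (τ m)) : ∑ m, τ m a ∈ maximalIdeal R ^ 2 := by
  induction ha using Submodule.iSup_induction' with
  | mem m₀ a ha =>
    have he : m₀ ^ orderOf m₀ = 1 := pow_orderOf_eq_one m₀
    have heu : IsUnit ((orderOf m₀ : ℕ) : R) := by
      obtain ⟨c, hc⟩ := orderOf_dvd_card (G := M) (x := m₀)
      have h : IsUnit (((orderOf m₀ : ℕ) : R) * (c : R)) := by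
        rw [← Nat.cast_mul, ← hc]; exact hMu
      exact isUnit_of_mul_isUnit_left h
    obtain ⟨y, -, hy⟩ := exists_sub_mem_sq_of_mem_augIdeal τ hres he heu ha
    have e : ∑ m, τ m a = ∑ m, τ m (a - (τ m₀ y - y)) + ∑ m, τ m (τ m₀ y - y) := by
      rw [← Finset.sum_add_distrib]
      refine Finset.sum_congr rfl fun m _ => ?_
      rw [← map_add, sub_add_cancel]
    rw [e, TameFixedLocus.sum_apply_sub_self τ m₀ y, add_zero]
    exact sum_mem fun m _ => TameEndState.apply_mem_sq_of_res τ m hy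
  | zero => simp
  | add a b _ _ ha hb =>
    simp_rw [map_add]
    rw [Finset.sum_add_distrib]
    exact add_mem ha hb

/-- **Subgroup form of ✓`mem_sq_of_mem_augIdeal_sup`**: for a tame residue-trivial action of the finite group `M`,
if `z ∈ 𝔞_M + 𝔪²` (`𝔞_M = ⨆_m 𝔞_m`, the fixed-locus ideal) and every `m ∈ M` fixes the line of `z`
(`τ m z − z ∈ 𝔪²`), then `z ∈ 𝔪²`: `|M|·z ≡ ∑_m τ m z ∈ 𝔪²`. [folklore] -/
theorem mem_sq_of_mem_iSup_augIdeal_sup (τ : M →* (R ≃+* R))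
    (hres : ∀ (m : M) (r : R), τ m r - r ∈ maximalIdeal R) (hMu : IsUnit ((Fintype.card M : ℕ) : R))
    {z : R} (hz : z ∈ (⨆ m, augIdeal (τ m)) ⊔ maximalIdeal R ^ 2)
    (hfix : ∀ m : M, τ m z - z ∈ maximalIdeal R ^ 2) : z ∈ maximalIdeal R ^ 2 := by
  obtain ⟨a, ha, b, hb, rfl⟩ := Submodule.mem_sup.mp hz
  have htr : ∑ m, τ m (a + b) ∈ maximalIdeal R ^ 2 := by
    simp_rw [map_add]
    rw [Finset.sum_add_distrib]
    exact add_mem (sum_apply_mem_sq_of_mem_iSup_augIdeal τ hres hMu ha)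
      (sum_mem fun m _ => TameEndState.apply_mem_sq_of_res τ m hb)
  have e : ((Fintype.card M : ℕ) : R) * (a + b) = ∑ m, τ m (a + b) - ∑ m, (τ m (a + b) - (a + b)) := by
    rw [Finset.sum_sub_distrib, Finset.sum_const, Finset.card_univ, nsmul_eq_mul]; ring
  have hcz : ((Fintype.card M : ℕ) : R) * (a + b) ∈ maximalIdeal R ^ 2 := by
    rw [e]
    exact sub_mem htr (sum_mem fun m _ => hfix m)
  obtain ⟨u, hu⟩ := hMu.exists_left_inv
  have e2 : a + b = u * (((Fintype.card M : ℕ) : R) * (a + b)) := by rw [← mul_assoc, hu, one_mul]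
  rw [e2]
  exact Ideal.mul_mem_left _ _ hcz

end LocalRing

/-! ## The germ of `Z_M` inside a finite union of divisors lies in one of them -/

section Point

variable {X : Scheme.{0}} {G : Type} [Group G] [Finite G] (σ : G →* Aut X) (p : ℕ) [Fact p.Prime]
  (x : X) [IsRegularLocalRing (X.presheaf.stalk x)] [CharP (ResidueField (X.presheaf.stalk x)) p]
  {I : Subgroup G} (a : I → (X.presheaf.stalk x ⟶ X.presheaf.stalk x))
  (τ : I →* (X.presheaf.stalk x ≃+* X.presheaf.stalk x))
  (hkey : ∀ g : I, Spec.map (a g) ≫ X.fromSpecStalk x = X.fromSpecStalk x ≫ (σ (g : G)).hom)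
  (hτ : ∀ (g : I) (r : X.presheaf.stalk x), τ g r = (a g⁻¹).hom r)
  {M : Subgroup G} (hM : M ≤ I)

include hkey hτ

/-- The fixed-locus ideal `𝔞_{M,x} = ⨆_{m ∈ M} 𝔞_{τ m}` of a tame subgroup `M ≤ I_x` on a regular stalk is prime
(its quotient is a regular local ring, ✓`TameFixedLocus.isRegularLocalRing_quotient_iSup_augIdeal`). [folklore] -/
theorem isPrime_iSup_augIdeal (hMcop : (Nat.card M).Coprime p) (hMx : M ≤ inertiaSubgroup σ x) :
    (⨆ k : M, augIdeal ((τ.comp (Subgroup.inclusion hM)) k)).IsPrime := by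
  have hMu : IsUnit ((Nat.card M : ℕ) : X.presheaf.stalk x) :=
    TameFixedLocus.isUnit_natCast_of_not_dvd p
      ((Nat.Prime.coprime_iff_not_dvd (Fact.out : p.Prime)).mp hMcop.symm)
  have hm : (⨆ k : M, augIdeal ((τ.comp (Subgroup.inclusion hM)) k)) ≤ maximalIdeal (X.presheaf.stalk x) :=
    (mem_inertLocus_iff_iSup_augIdeal_le σ x a τ hkey hτ hM).mp hMx
  haveI hreg := TameFixedLocus.isRegularLocalRing_quotient_iSup_augIdeal (τ.comp (Subgroup.inclusion hM)) hMu hm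
  haveI : IsDomain (X.presheaf.stalk x ⧸ ⨆ k : M, augIdeal ((τ.comp (Subgroup.inclusion hM)) k)) :=
    isDomain_of_isRegularLocalRing _
  exact (Ideal.Quotient.isDomain_iff_prime _).mp this

/-- **Germ form** (subgroup version of ✓`exists_mem_of_stalkIdeal_suppUnion_le`): if `I(⋃_{D ∈ L} supp D)_x ≤ 𝔞_{M,x}`
for a tame `M ≤ I_x`, some `D ∈ L` passes through `x` with `I(supp D)_x ≤ 𝔞_{M,x}`. [folklore] -/
theorem exists_mem_of_stalkIdeal_suppUnion_le_iSup (hMcop : (Nat.card M).Coprime p)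
    (hMx : M ≤ inertiaSubgroup σ x) :
    ∀ (L : List X.IdealSheafData), stalkIdeal (vanishingIdeal (⟨⋃ D' ∈ L, (D'.support : Set X),
      Set.Finite.isClosed_biUnion (List.finite_toSet L) fun D' _ => D'.support.isClosed⟩ : Closeds X)) x ≤
        ⨆ k : M, augIdeal ((τ.comp (Subgroup.inclusion hM)) k) →
      ∃ D ∈ L, x ∈ D.support ∧
        stalkIdeal (vanishingIdeal D.support) x ≤ ⨆ k : M, augIdeal ((τ.comp (Subgroup.inclusion hM)) k) := by
  have hprime := isPrime_iSup_augIdeal σ p x a τ hkey hτ hM hMcop hMx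
  intro L
  induction L with
  | nil =>
    intro h
    exfalso
    have hempty : (⟨⋃ D' ∈ ([] : List X.IdealSheafData), (D'.support : Set X),
        Set.Finite.isClosed_biUnion (List.finite_toSet []) fun D' _ => D'.support.isClosed⟩ : Closeds X) = ⊥ := by
      ext y; simp
    rw [hempty] at h
    have htop : stalkIdeal (vanishingIdeal (⊥ : Closeds X)) x = ⊤ := by
      apply stalkIdeal_eq_top_of_not_mem_support
      rw [← SetLike.mem_coe, Scheme.IdealSheafData.coe_support_vanishingIdeal]
      exact fun h => h
    rw [htop, top_le_iff] at h
    exact hprime.ne_top h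
  | cons D L ih =>
    intro h
    have hunion : (⟨⋃ D' ∈ (D :: L), (D'.support : Set X),
        Set.Finite.isClosed_biUnion (List.finite_toSet (D :: L)) fun D' _ => D'.support.isClosed⟩ : Closeds X) =
        D.support ⊔ ⟨⋃ D' ∈ L, (D'.support : Set X),
          Set.Finite.isClosed_biUnion (List.finite_toSet L) fun D' _ => D'.support.isClosed⟩ := by
      ext y
      simp
    rw [hunion, vanishingIdeal_sup, stalkIdeal_inf] at h
    rcases hprime.inf_le.mp h with hD | hB
    · refine ⟨D, List.mem_cons_self, ?_, hD⟩
      by_contra hxD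
      have : stalkIdeal (vanishingIdeal D.support) x = ⊤ := by
        have hsupp : (vanishingIdeal D.support).support = D.support :=
          TopologicalSpace.Closeds.ext (Scheme.IdealSheafData.coe_support_vanishingIdeal (Z := D.support))
        exact stalkIdeal_eq_top_of_not_mem_support (hsupp ▸ hxD)
      rw [this, top_le_iff] at hD
      exact hprime.ne_top hD
    · obtain ⟨D', hD', hx', hle⟩ := ih hB
      exact ⟨D', List.mem_cons_of_mem D hD', hx', hle⟩

/-- **The germ of the inert locus `Z_M` of a tame subgroup inside a finite union of divisors lies in one of them**:
if `Z_M ⊆ ⋃_{D ∈ L} supp D`, `M ≤ I_x` tame, regular stalk, `Z_M` closed, some `D ∈ L` through `x` has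
`I(supp D)_x ≤ 𝔞_{M,x}` (✓`stalkIdeal_vanishingIdeal_inertLocus_of_isUnit`). [folklore] -/
theorem exists_mem_stalkIdeal_le_iSup_of_subset_iUnion (hMcop : (Nat.card M).Coprime p)
    (hMx : M ≤ inertiaSubgroup σ x) (hZ : IsClosed {y : X | M ≤ inertiaSubgroup σ y}) (L : List X.IdealSheafData)
    (h : {y : X | M ≤ inertiaSubgroup σ y} ⊆ ⋃ D ∈ L, (D.support : Set X)) :
    ∃ D ∈ L, x ∈ D.support ∧
      stalkIdeal (vanishingIdeal D.support) x ≤ ⨆ k : M, augIdeal ((τ.comp (Subgroup.inclusion hM)) k) := by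
  classical
  haveI : Fintype M := Fintype.ofFinite M
  refine exists_mem_of_stalkIdeal_suppUnion_le_iSup σ p x a τ hkey hτ hM hMcop hMx L fun z hz => ?_
  have hle : (⟨{y : X | M ≤ inertiaSubgroup σ y}, hZ⟩ : Closeds X) ≤
      (⟨⋃ D' ∈ L, (D'.support : Set X),
        Set.Finite.isClosed_biUnion (List.finite_toSet L) fun D' _ => D'.support.isClosed⟩ : Closeds X) :=
    fun y hy => h hy
  have hMu : IsUnit ((Nat.card M : ℕ) : X.presheaf.stalk x) :=
    TameFixedLocus.isUnit_natCast_of_not_dvd p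
      ((Nat.Prime.coprime_iff_not_dvd (Fact.out : p.Prime)).mp hMcop.symm)
  rw [← stalkIdeal_vanishingIdeal_inertLocus_of_isUnit σ x a τ hkey hτ hM hMu hMx hZ]
  exact stalkIdeal_mono (vanishingIdeal_antimono hle) x hz

omit [Finite G] [IsRegularLocalRing (X.presheaf.stalk x)] in
/-- **The joint kernel of the line characters of `I_x`, with its defining property** (`u ∈ U` fixes every boundary
line to first order), pushed into `G`: `U ≤ I`, normal in `I`, containing the commutators, closed under `p`-th
roots. [folklore] -/
theorem exists_lineKernel (hIx : I ≤ inertiaSubgroup σ x) {n : ℕ} (z : Fin n → X.presheaf.stalk x)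
    (hz : ∀ i, z i ∈ maximalIdeal (X.presheaf.stalk x))
    (hstab : ∀ (g : I) (i : Fin n), τ g (z i) ∈ Ideal.span {z i} ⊔ maximalIdeal (X.presheaf.stalk x) ^ 2) :
    ∃ U : Subgroup G, U ≤ I ∧ (∀ h ∈ I, ∀ u ∈ U, h * u * h⁻¹ ∈ U) ∧
      (∀ a' ∈ I, ∀ b ∈ I, a' * b * a'⁻¹ * b⁻¹ ∈ U) ∧ (∀ g ∈ I, g ^ p ∈ U → g ∈ U) ∧
      ∀ u : I, (u : G) ∈ U → ∀ i, τ u (z i) - z i ∈ maximalIdeal (X.presheaf.stalk x) ^ 2 := by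
  have hres : ∀ (g : I) (s : X.presheaf.stalk x), τ g s - s ∈ maximalIdeal (X.presheaf.stalk x) :=
    stalkAction_residueTrivial σ x a τ hkey hτ hIx
  choose ν hν using fun i => exists_character_of_stable_line τ hres (hz i) (fun g => hstab g i)
  let f : I →* (Fin n → (ResidueField (X.presheaf.stalk x))ˣ) := MonoidHom.pi ν
  have hmem : ∀ {u : I}, (u : G) ∈ f.ker.map I.subtype ↔ u ∈ f.ker := by
    intro u
    constructor
    · intro h
      obtain ⟨v, hv, hvu⟩ := Subgroup.mem_map.mp h
      have : v = u := Subtype.ext (by simpa using hvu)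
      exact this ▸ hv
    · intro h
      exact Subgroup.mem_map.mpr ⟨u, h, rfl⟩
  refine ⟨f.ker.map I.subtype, fun g hg => ?_, fun h hh u hu => ?_, fun a' ha' b hb => ?_,
    fun g hg hgp => ?_, fun u hu i => ?_⟩
  · obtain ⟨v, -, rfl⟩ := Subgroup.mem_map.mp hg
    exact v.2
  · obtain ⟨v, hv, rfl⟩ := Subgroup.mem_map.mp hu
    have h' : ((⟨h, hh⟩ * v * ⟨h, hh⟩⁻¹ : I) : G) = h * (v : G) * h⁻¹ := rfl
    rw [Subgroup.coe_subtype, ← h']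
    exact hmem.mpr ((inferInstance : f.ker.Normal).conj_mem v hv ⟨h, hh⟩)
  · have h' : ((⟨a', ha'⟩ * ⟨b, hb⟩ * ⟨a', ha'⟩⁻¹ * ⟨b, hb⟩⁻¹ : I) : G) = a' * b * a'⁻¹ * b⁻¹ := rfl
    rw [← h']
    exact hmem.mpr (commutatorElement_mem_ker f _ _)
  · have h' : ((⟨g, hg⟩ ^ p : I) : G) = g ^ p := rfl
    rw [← h'] at hgp
    exact (hmem (u := ⟨g, hg⟩)).mpr
      (mem_ker_of_pow_mem_ker (pi_units_eq_one_of_pow_char_eq_one p) f (hmem.mp hgp))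
  · have hu' : f u = 1 := MonoidHom.mem_ker.mp (hmem.mp hu)
    exact hν i u (by rw [← MonoidHom.pi_apply ν u i]; exact congrFun hu' i ▸ rfl)

end Point

end Summit.ResolutionOfSingularities.ResolutionOfSingularities.Theorems.WildQuotientResolution.StandardForm

end
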